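/-
Copyright: cell `pub-ymgap` (HUMAN RULING D-0062), Track A of `YM-PLAN.md`, DAG node N20 (= NE7b); R134 acceleration seat
`pub-ymgap-dag-n20-c` (strategy s1, generation 10), module 50.  Released under the licence of the surrounding project.
-/
import Summits.QuantumFields.YangMills.Theorems.BalabanUVNodesN20LCSHullSeparation
import Mathlib.Data.Int.CardIntervalMod
import HarnessLib

/-!
# YM-DAG node N20 (= NE7b), row s1, module 50: FINE-TORUS COUNTING — seam-aware nearness of the cubes of def-R's partition (no divisibility
# letter), at most `39^d` cube indices near a given one, equally spaced residues in a window, at most `ℓ^d` sites of `T^{(j)}` in a collar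

Track A of `YM-PLAN.md` (cell `pub-ymgap`, HUMAN RULING D-0062), node **N20** = spine estimate NE7b (`T4WeightBudget.RelWeightBound`, NOT
PRINTED, NOT PROVED).  Seat `pub-ymgap-dag-n20-c` (R134, s1), generation 10, module 50 (imports module 42 `…N20LCSHullSeparation` for its §1 torus
toolkit over dag-n12-e's `coordDist`, and Mathlib's `Data.Int.CardIntervalMod`).  Kernel theorems only, generic in `P : Params`: 0 `def`, 0 `sorry`,
standard axioms; COUNT-NEUTRAL.  Lattice combinatorics of the torus of record `T_η = ℤᵈ ∕ 2L^{m+K}ℤᵈ`; it asserts nothing of Bałaban's.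

WHY.  Module 49 §4 (the N20 instance at the record modulo (W) + (T♮) + (R)) still asked its CONSUMER for a skeleton of the pinned family (a sub-family with
pairwise disjoint canonical regions `R♮_j(c)`, density `#D ≤ K·#D′`) and for the size `#R♮_j(c) ≤ m` — displayed as hypotheses, «counting not typed».  The
counting is finite combinatorics on the torus; THIS FILE supplies the generic part, module 51 `…N20LCSCanonicalSkeleton` reads it at def-R's χ_{k+1}-cubes:
* `coordDist_cover_lt_iff` — the cyclic distance of two cover images `π x`, `π y` (`x, y ∈ ℤᵈ`), read on the integer residues `(x i − y i) mod n`;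
* ★ **`near_index_cases`** — SEAM-AWARE NEARNESS: if the corners `s·α, s·β < n` of two cubes of the `s`-partition of a cycle of length `n` are `< 10s` apart
  cyclically, then `β ∈ [α − 9, α + 9] ∪ [0, 9] ∪ [⌊n∕s⌋ − 9, ⌊n∕s⌋]` — the last two windows are the two sides of the seam of def-R's partition `cubeIndices`
  (`⌈n∕s⌉` cubes per direction, the last one truncated when `s ∤ n`); NO divisibility letter is used;
* `exists_nat_of_mem_cubeIndices` (indices have natural coordinates with corners `< n`); ★ **`card_filter_near_le`** — at most `39^d` indices of the
  partition have their corner within cyclic distance `< 10s` of a given corner in every coordinate (`19 + 10 + 10` per coordinate; crude — print's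
  geometry gives `≈ 20^d` —, only finiteness matters downstream);
* `card_filter_residue_le` — the equally spaced residues `e·t + off (mod e·n′)`, `t < n′`, hit a window of `ℓ·e` consecutive integers at most `ℓ` times
  (a hit determines an integer `≡ off (mod e)` of the window, injectively in `t`; Mathlib's `Int.Ico_filter_modEq_card` counts exactly `ℓ` of those);
* ★ **`card_filter_embIter_mem_cubeEnl_le`** — at most `ℓ^d` sites of `T^{(j)}` embed (by `embIter j`, affine with slope `L^j` on labels — module 42 §1
  `val_embIter_eq_pow_mul_add`; `2L^{m+K} = L^j · 2L^{m+K−j}`) into the `w`-collar of an `s`-cube when `(2w+1)·s = ℓ·L^j`;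
* `card_filter_plaq_le` — plaquettes whose source satisfies a predicate number `≤ d²` times the sources.

HONEST FRAMING.  Counting on a finite torus; no estimate of Bałaban's; nothing of N20's walls ((W) = (A1c); (T♮) = the local [Balaban1985Variational] Thm 1 (9))
is touched here.  NE7b NOT PRINTED ∕ NOT PROVED; (α)-instance 0∕1; N20 NOT discharged; typed 28∕28, count untouched; one finite four-torus at fixed `ε` —
NOT ℝ⁴, NOT infinite volume, NOT OS, NOT a mass gap, NOT Clay.

References (LOCATORS): T. Bałaban, CMP 109 (1987) 249–301 [Balaban1987RG1] ((0.1) p.251–252: the tori `T^{(j)}`, the lattices of centres); CMP 119 (1988)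
243–285 [Balaban1988Convergent] ((2.16)–(2.17) p.257: the cube partition and the collars `□^{∼n}`); CMP 122 (1989) 355–392 [Balaban1989LargeFieldII]
((1.79)–(1.80) pp.383–384: one small factor per large-field cube, up to geometric constants); Commun. Math. Phys. 98 (1985) 17–51 [Balaban1985Averaging]
((5) p.18: the plaquette convention).
-/

set_option autoImplicit false

noncomputable section

open scoped BigOperators ENNReal

namespace Summit.QuantumFields.YangMills.BalabanUVNodes.N20LCSTorusCounting

open Literature.MathematicalPhysics.QuantumFieldTheory.Balaban1983to89
open Literature.MathematicalPhysics.QuantumFieldTheory.Balaban1983to89.Node00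
open B15DeterminingSets B14.Eq213MaximalDomains B15Eq112TorusCover B14DomainGeom
open Literature.MathematicalPhysics.QuantumFieldTheory.Balaban1983to89.B15Claim189LambdaPin (coordDist)
open Summit.QuantumFields.YangMills.BalabanUVNodes.N20LCSHullSeparation (val_embIter_eq_pow_mul_add)

/-! ## §1 Fine-torus counting over `coordDist` and the cover (generic `P : Params`) -/

section Lattice

variable {P : Params}

/-- **THE CYCLIC DISTANCE OF TWO COVER IMAGES READ ON REPRESENTATIVES**: for `x, y ∈ ℤᵈ`, `coordDist (π x) (π y) i < t` iff one of the two integer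
residues `(x i − y i) mod n`, `(y i − x i) mod n` (`n = 2L^{m+K}` the period) is `< t`. [cite: Balaban1987RG1, (0.1) p.251 (the torus; bookkeeping)] -/
theorem coordDist_cover_lt_iff (x y : Pt P.d) (i : Fin P.d) (t : ℕ) :
    coordDist (cover P x) (cover P y) i < t ↔
      (x i - y i) % (P.sitesPerDir 0 : ℕ) < (t : ℤ) ∨ (y i - x i) % (P.sitesPerDir 0 : ℕ) < (t : ℤ) := by
  have key : ∀ x y : Pt P.d, (((cover P x i - cover P y i).val : ℕ) : ℤ) = (x i - y i) % (P.sitesPerDir 0 : ℕ) := by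
    intro x y
    have : cover P x i - cover P y i = ((x i - y i : ℤ) : ZMod (P.sitesPerDir 0)) := by simp [Int.cast_sub]
    rw [this, ZMod.val_intCast]
  unfold coordDist
  rw [min_lt_iff]
  have e1 := key x y
  have e2 := key y x
  constructor
  · rintro (h | h)
    · left; rw [← e1]; exact_mod_cast h
    · right; rw [← e2]; exact_mod_cast h
  · rintro (h | h)
    · left; rw [← e1] at h; exact_mod_cast h
    · right; rw [← e2] at h; exact_mod_cast h

/-- ★ **SEAM-AWARE NEARNESS OF CUBE INDICES** (one coordinate): if the corners `s·α, s·β < n` of two cubes of the `s`-partition of a cycle of length `n` are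
`< 10·s` apart cyclically — one of the residues `(sα − sβ) mod n`, `(sβ − sα) mod n` is `< 10s` —, then `β` lies in `[α − 9, α + 9]` (no wrap), or in
`[0, 9]` or `[⌊n∕s⌋ − 9, ⌊n∕s⌋]` (the two sides of the seam of def-R's partition `cubeIndices`; its last cube is truncated when `s ∤ n`, and NO divisibility
is assumed). [cite: Balaban1988Convergent, (2.17) p.257 (the cube partition; bookkeeping)] -/
theorem near_index_cases {n s : ℕ} (hs : 0 < s) {α β : ℕ} (hα : s * α < n) (hβ : s * β < n)
    (h : (((s * α : ℕ) : ℤ) - ((s * β : ℕ) : ℤ)) % (n : ℤ) < ((10 * s : ℕ) : ℤ) ∨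
      (((s * β : ℕ) : ℤ) - ((s * α : ℕ) : ℤ)) % (n : ℤ) < ((10 * s : ℕ) : ℤ)) :
    (α ≤ β + 9 ∧ β ≤ α + 9) ∨ β ≤ 9 ∨ (n / s ≤ β + 9 ∧ β ≤ n / s) := by
  -- `β ≤ ⌊n∕s⌋` always
  have hβd : β ≤ n / s := by
    rw [Nat.le_div_iff_mul_le hs]; rw [mul_comm]; exact hβ.le
  -- the residues of a difference `D ∈ (−n, n)`: `D` itself if `D ≥ 0`, `D + n` otherwise
  have key : ∀ {A B : ℕ}, A < n → B < n →
      (((A : ℤ) - B) % (n : ℤ) < ((10 * s : ℕ) : ℤ)) → (B ≤ A ∧ A < B + 10 * s) ∨ (A < B ∧ n + A < B + 10 * s) := by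
    intro A B hA hB hlt
    by_cases hAB : B ≤ A
    · left
      have h0 : ((A : ℤ) - B) % (n : ℤ) = (A : ℤ) - B :=
        Int.emod_eq_of_lt (by omega) (by omega)
      rw [h0] at hlt
      exact ⟨hAB, by omega⟩
    · right
      push Not at hAB
      -- the residue of `D = A − B ∈ (−n, 0)` is `D + n`
      have h1 : ((A : ℤ) - B + n) % (n : ℤ) = ((A : ℤ) - B) % (n : ℤ) := by simp
      have h0 : ((A : ℤ) - B) % (n : ℤ) = (A : ℤ) - B + n :=
        h1.symm.trans (Int.emod_eq_of_lt (by omega) (by omega))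
      rw [h0] at hlt
      exact ⟨hAB, by omega⟩
  rcases h with h | h
  · rcases key hα hβ h with ⟨h1, h2⟩ | ⟨h1, h2⟩
    · -- `sβ ≤ sα < sβ + 10 s`: no wrap, `β ≤ α ≤ β + 9`
      left
      have h3 : s * α < s * (β + 10) := by rw [mul_add]; omega
      have h4 := Nat.lt_of_mul_lt_mul_left h3
      have h5 : β ≤ α := Nat.le_of_mul_le_mul_left h1 hs
      omega
    · -- `sα < sβ` and `n + sα < sβ + 10 s`: `β` at the top seam
      right; right
      refine ⟨?_, hβd⟩
      have h3 : n < s * (β + 10) := by rw [mul_add]; omega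
      have h4 : n / s < β + 10 := (Nat.div_lt_iff_lt_mul hs).2 (by rw [mul_comm] at h3; exact h3)
      omega
  · rcases key hβ hα h with ⟨h1, h2⟩ | ⟨h1, h2⟩
    · -- `sα ≤ sβ < sα + 10 s`: no wrap, `α ≤ β ≤ α + 9`
      left
      have h3 : s * β < s * (α + 10) := by rw [mul_add]; omega
      have h4 := Nat.lt_of_mul_lt_mul_left h3
      have h5 : α ≤ β := Nat.le_of_mul_le_mul_left h1 hs
      omega
    · -- `sβ < sα < n` and `n + sβ < sα + 10 s`: then `sβ < 10 s` — `β` at the bottom seam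
      right; left
      have h3 : s * β < s * 10 := by omega
      have h4 := Nat.lt_of_mul_lt_mul_left h3
      omega

/-- A cube index of def-R's partition has natural coordinates `< ⌈n∕s⌉`, whose corners `s·α_i` are `< n`. [cite: Balaban1988Convergent, (2.17) p.257 (bookkeeping)] -/
theorem exists_nat_of_mem_cubeIndices {s : ℕ} (hs : 0 < s) {a : Pt P.d} (ha : a ∈ cubeIndices P s) (i : Fin P.d) :
    ∃ α : ℕ, a i = (α : ℤ) ∧ s * α < P.sitesPerDir 0 := by
  unfold cubeIndices at ha
  rw [Fintype.mem_piFinset] at ha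
  obtain ⟨α, hα, hαeq⟩ := Finset.mem_image.1 (ha i)
  refine ⟨α, hαeq.symm, ?_⟩
  rw [Finset.mem_range] at hα
  have hn : 0 < P.sitesPerDir 0 := Nat.pos_of_ne_zero (P.sitesPerDir_ne_zero 0)
  -- `α + 1 ≤ (n + s − 1) ∕ s` ⇒ `(α + 1)·s ≤ n + s − 1`
  have h1 : (α + 1) * s ≤ P.sitesPerDir 0 + s - 1 := (Nat.le_div_iff_mul_le hs).1 (by omega)
  rw [add_mul, one_mul, mul_comm] at h1
  omega

/-- ★ **AT MOST `39^d` CUBE INDICES ARE NEAR A GIVEN ONE**: the indices `b` of def-R's `s`-partition whose corner `π(s·b)` is within cyclic distance `< 10s`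
of the corner `π(s·a)` of `a` in EVERY coordinate number at most `39^d` (per coordinate: `19` unwrapped + `10 + 10` at the seam, §1 `near_index_cases`).
[cite: Balaban1988Convergent, (2.17) p.257; Balaban1989LargeFieldII, (1.79)–(1.80) pp.383–384 (geometric constants)] -/
theorem card_filter_near_le {s : ℕ} (hs : 0 < s) {a : Pt P.d} (ha : a ∈ cubeIndices P s) :
    ((cubeIndices P s).filter fun b : Pt P.d =>
        ∀ i, coordDist (cover P fun j => (s : ℤ) * a j) (cover P fun j => (s : ℤ) * b j) i < 10 * s).card ≤ 39 ^ P.d := by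
  classical
  -- the admissible coordinate values, per coordinate: `[α−9, α+9] ∪ [0, 9] ∪ [⌊n∕s⌋−9, ⌊n∕s⌋]`
  set T : Fin P.d → Finset ℤ := fun i =>
    ((Finset.Icc ((a i).toNat - 9) ((a i).toNat + 9) ∪
        (Finset.Icc 0 9 ∪ Finset.Icc (P.sitesPerDir 0 / s - 9) (P.sitesPerDir 0 / s))).image (Nat.cast : ℕ → ℤ)) with hT
  have hTcard : ∀ i, (T i).card ≤ 39 := by
    intro i
    refine Finset.card_image_le.trans ((Finset.card_union_le _ _).trans ?_)
    have h1 : (Finset.Icc ((a i).toNat - 9) ((a i).toNat + 9)).card ≤ 19 := by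
      rw [Nat.card_Icc]; omega
    have h2 : (Finset.Icc 0 9 ∪ Finset.Icc (P.sitesPerDir 0 / s - 9) (P.sitesPerDir 0 / s)).card ≤ 20 := by
      refine (Finset.card_union_le _ _).trans ?_
      rw [Nat.card_Icc, Nat.card_Icc]; omega
    omega
  -- the near indices lie in the box `Π_i T i`
  have hsub : ((cubeIndices P s).filter fun b : Pt P.d =>
      ∀ i, coordDist (cover P fun j => (s : ℤ) * a j) (cover P fun j => (s : ℤ) * b j) i < 10 * s) ⊆
      Fintype.piFinset T := by
    intro b hb
    rw [Finset.mem_filter] at hb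
    obtain ⟨hb, hnear⟩ := hb
    rw [Fintype.mem_piFinset]
    intro i
    obtain ⟨α, hαeq, hα⟩ := exists_nat_of_mem_cubeIndices hs ha i
    obtain ⟨β, hβeq, hβ⟩ := exists_nat_of_mem_cubeIndices hs hb i
    have hi := (coordDist_cover_lt_iff (P := P) (fun j => (s : ℤ) * a j) (fun j => (s : ℤ) * b j) i (10 * s)).1 (hnear i)
    simp only [hαeq, hβeq] at hi
    have hi' : (((s * α : ℕ) : ℤ) - ((s * β : ℕ) : ℤ)) % ((P.sitesPerDir 0 : ℕ) : ℤ) < ((10 * s : ℕ) : ℤ) ∨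
        (((s * β : ℕ) : ℤ) - ((s * α : ℕ) : ℤ)) % ((P.sitesPerDir 0 : ℕ) : ℤ) < ((10 * s : ℕ) : ℤ) := by
      push_cast at hi ⊢; exact hi
    have hcases := near_index_cases hs hα hβ hi'
    have hαn : (a i).toNat = α := by rw [hαeq, Int.toNat_natCast]
    rw [hT]
    dsimp only
    rw [hαn, hβeq]
    refine Finset.mem_image.2 ⟨β, ?_, rfl⟩
    rcases hcases with ⟨h1, h2⟩ | h1 | ⟨h1, h2⟩
    · exact Finset.mem_union_left _ (Finset.mem_Icc.2 ⟨by omega, by omega⟩)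
    · exact Finset.mem_union_right _ (Finset.mem_union_left _ (Finset.mem_Icc.2 ⟨by omega, by omega⟩))
    · exact Finset.mem_union_right _ (Finset.mem_union_right _ (Finset.mem_Icc.2 ⟨by omega, by omega⟩))
  refine (Finset.card_le_card hsub).trans ?_
  rw [Fintype.card_piFinset]
  calc ∏ i, (T i).card ≤ ∏ _i : Fin P.d, 39 := Finset.prod_le_prod' fun i _ => hTcard i
    _ = 39 ^ P.d := by rw [Finset.prod_const, Finset.card_univ, Fintype.card_fin]

open Classical in
/-- **EQUALLY SPACED RESIDUES IN A WINDOW**: the residues `e·t + off (mod n)`, `t < n′`, `n = e·n′`, hit a window of `ℓ·e` consecutive integers at most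
`ℓ` times (a hit determines an integer `z ≡ off (mod e)` of the window, injectively in `t`; there are exactly `ℓ` such integers).
[cite: Balaban1987RG1, (0.1) p.251–252 (the lattices `T^{(j)} ⊂ T_η`; bookkeeping)] -/
theorem card_filter_residue_le {n e n' : ℕ} (hn : n = e * n') (he : 0 < e) (off : ℕ) (lo : ℤ) (ℓ : ℕ) :
    ((Finset.range n').filter fun t : ℕ =>
        ∃ z : ℤ, lo ≤ z ∧ z < lo + ℓ * e ∧ (z : ZMod n) = ((e * t + off : ℕ) : ZMod n)).card ≤ ℓ := by
  classical
  subst hn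
  set S := (Finset.range n').filter fun t : ℕ =>
    ∃ z : ℤ, lo ≤ z ∧ z < lo + ℓ * e ∧ (z : ZMod (e * n')) = ((e * t + off : ℕ) : ZMod (e * n')) with hS
  -- the window's integers congruent to `off` modulo `e`: exactly `ℓ` of them
  set W := (Finset.Ico lo (lo + ℓ * e)).filter fun z : ℤ => z ≡ (off : ℤ) [ZMOD (e : ℤ)] with hW
  have he' : (0 : ℤ) < e := by exact_mod_cast he
  have hWcard : W.card = ℓ := by
    have h := Int.Ico_filter_modEq_card lo (lo + ℓ * e) he' (off : ℤ)
    have h1 : ((lo + (ℓ : ℤ) * (e : ℤ) : ℤ) - ((off : ℕ) : ℤ) : ℚ) / ((e : ℤ) : ℚ) =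
        ((lo : ℤ) - ((off : ℕ) : ℤ) : ℚ) / ((e : ℤ) : ℚ) + (ℓ : ℕ) := by
      have he'' : ((e : ℤ) : ℚ) ≠ 0 := by exact_mod_cast he.ne'
      field_simp
      push_cast
      ring
    rw [hW]
    push_cast at h h1 ⊢
    rw [h1, Int.ceil_add_natCast, add_sub_cancel_left, max_eq_left (by positivity)] at h
    exact_mod_cast h
  -- the chosen window integer of a hit
  have hchoose : ∀ t ∈ S, ∃ z : ℤ, lo ≤ z ∧ z < lo + ℓ * e ∧ (z : ZMod (e * n')) = ((e * t + off : ℕ) : ZMod (e * n')) :=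
    fun t ht => (Finset.mem_filter.1 ht).2
  choose! f hf using hchoose
  have hmod : ∀ t ∈ S, f t ≡ (off : ℤ) [ZMOD (e : ℤ)] := by
    intro t ht
    obtain ⟨-, -, h3⟩ := hf t ht
    have h4 : (f t : ZMod (e * n')) = (((e * t + off : ℕ) : ℤ) : ZMod (e * n')) := by rw [h3, Int.cast_natCast]
    rw [ZMod.intCast_eq_intCast_iff_dvd_sub] at h4
    -- `e n′ ∣ (e t + off) − f t`, and `e ∣ e n′`
    have hen : (e : ℤ) ∣ ((e * n' : ℕ) : ℤ) := ⟨n', by push_cast; ring⟩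
    have h5 : (e : ℤ) ∣ ((e * t + off : ℕ) : ℤ) - f t := hen.trans h4
    have h6 : (e : ℤ) ∣ (off : ℤ) - f t := by
      have h7 := dvd_sub h5 (dvd_mul_right (e : ℤ) (t : ℤ))
      have : ((e * t + off : ℕ) : ℤ) - f t - (e : ℤ) * t = (off : ℤ) - f t := by push_cast; ring
      rwa [this] at h7
    exact Int.modEq_iff_dvd.2 h6
  refine le_of_le_of_eq (Finset.card_le_card_of_injOn f (fun t ht => ?_) ?_) hWcard
  · have ht' : t ∈ S := Finset.mem_coe.1 ht
    obtain ⟨h1, h2, -⟩ := hf t ht'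
    rw [Finset.mem_coe, hW, Finset.mem_filter, Finset.mem_Ico]
    exact ⟨⟨h1, h2⟩, hmod t ht'⟩
  · intro t₁ ht₁ t₂ ht₂ heq
    have ht₁' : t₁ ∈ S := Finset.mem_coe.1 ht₁
    have ht₂' : t₂ ∈ S := Finset.mem_coe.1 ht₂
    obtain ⟨-, -, h1⟩ := hf t₁ ht₁'
    obtain ⟨-, -, h2⟩ := hf t₂ ht₂'
    have hlt₁ := Finset.mem_range.1 (Finset.mem_filter.1 ht₁').1
    have hlt₂ := Finset.mem_range.1 (Finset.mem_filter.1 ht₂').1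
    rw [heq] at h1
    have h3 : (((e * t₁ + off : ℕ) : ℤ) : ZMod (e * n')) = (((e * t₂ + off : ℕ) : ℤ) : ZMod (e * n')) := by
      rw [Int.cast_natCast, Int.cast_natCast]; exact h1.symm.trans h2
    rw [ZMod.intCast_eq_intCast_iff_dvd_sub] at h3
    -- `e n′ ∣ e (t₂ − t₁)` ⇒ `n′ ∣ t₂ − t₁` ⇒ `t₁ = t₂`
    have h4 : (e : ℤ) * n' ∣ (e : ℤ) * ((t₂ : ℤ) - t₁) := by
      convert h3 using 1 <;> push_cast <;> ring
    have h5 : (n' : ℤ) ∣ (t₂ : ℤ) - t₁ := (mul_dvd_mul_iff_left he'.ne').1 h4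
    have h6 := Int.eq_zero_of_abs_lt_dvd h5 (by rw [abs_lt]; constructor <;> omega)
    omega

open Classical in
/-- ★ **AT MOST `ℓ^d` SITES OF `T^{(j)}` EMBED INTO THE `w`-COLLAR OF AN `s`-CUBE** when `(2w+1)·s = ℓ·L^j` (`j ≤ m + K`): `embIter j` is affine with slope
`L^j` on labels (module 42 §1 `val_embIter_eq_pow_mul_add`), the finest torus has `L^j` times the sites of `T^{(j)}` per direction, and the collar is the
cover image of a box with sides `(2w+1)·s`; per coordinate §1 `card_filter_residue_le`. [cite: Balaban1987RG1, (0.1) p.251–252; Balaban1988Convergent, (2.16)–(2.17) p.257] -/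
theorem card_filter_embIter_mem_cubeEnl_le {j : ℕ} (hj : j ≤ P.m + P.K) {s w ℓ : ℕ} (hℓ : (2 * w + 1) * s = ℓ * P.L ^ j)
    (a : Pt P.d) :
    ((Finset.univ : Finset (Site P j)).filter fun x => embIter j x ∈ cubeEnl P s a w).card ≤ ℓ ^ P.d := by
  classical
  obtain ⟨off, hoff⟩ := val_embIter_eq_pow_mul_add (P := P) hj
  have hL : 0 < P.L := P.L_pos
  have he : 0 < P.L ^ j := pow_pos hL _
  have hn : P.sitesPerDir 0 = P.L ^ j * P.sitesPerDir j := by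
    unfold Params.sitesPerDir
    rw [Nat.sub_zero, mul_left_comm, ← pow_add, Nat.add_sub_cancel' hj]
  -- per coordinate: the labels `t < sitesPerDir j` whose fine position `L^j t + off` hits the collar's `i`-th window
  set T : Fin P.d → Finset ℕ := fun i =>
    (Finset.range (P.sitesPerDir j)).filter fun t : ℕ =>
      ∃ z : ℤ, (s : ℤ) * a i - (w * s : ℕ) ≤ z ∧ z < (s : ℤ) * a i - (w * s : ℕ) + ℓ * (P.L ^ j : ℕ) ∧
        (z : ZMod (P.sitesPerDir 0)) = ((P.L ^ j * t + off : ℕ) : ZMod (P.sitesPerDir 0)) with hT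
  have hTcard : ∀ i, (T i).card ≤ ℓ := fun i => card_filter_residue_le hn he off _ ℓ
  -- the sites of the filter, read through their labels, lie in `Π_i T i`
  have hmaps : ∀ x ∈ ((Finset.univ : Finset (Site P j)).filter fun x => embIter j x ∈ cubeEnl P s a w),
      (fun i => (x i).val) ∈ Fintype.piFinset T := by
    intro x hx
    rw [Finset.mem_filter] at hx
    obtain ⟨z, hz, hzx⟩ := hx.2
    rw [Fintype.mem_piFinset]
    intro i
    rw [hT]
    dsimp only
    rw [Finset.mem_filter, Finset.mem_range]
    refine ⟨ZMod.val_lt _, z i, ?_, ?_, ?_⟩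
    · have h1 := (hz i).1
      push_cast at h1 ⊢
      linarith
    · have h1 := (hz i).2
      have h2 : ((w * s + s + w * s : ℕ) : ℤ) = ((ℓ * P.L ^ j : ℕ) : ℤ) := by
        rw [← hℓ]; push_cast; ring
      push_cast at h1 h2 ⊢
      linarith
    · have h3 : (z i : ZMod (P.sitesPerDir 0)) = (embIter j x) i := by rw [← hzx]; rfl
      rw [h3, ← ZMod.natCast_zmod_val ((embIter j x) i), hoff x i]
  refine (Finset.card_le_card_of_injOn (fun x i => (x i).val)
    (fun x hx => Finset.mem_coe.2 (hmaps x (Finset.mem_coe.1 hx))) ?_).trans ?_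
  · intro x₁ _ x₂ _ heq
    funext i
    have hi : (x₁ i).val = (x₂ i).val := congrFun heq i
    exact ZMod.val_injective _ hi
  · rw [Fintype.card_piFinset]
    calc ∏ i, (T i).card ≤ ∏ _i : Fin P.d, ℓ := Finset.prod_le_prod' fun i _ => hTcard i
      _ = ℓ ^ P.d := by rw [Finset.prod_const, Finset.card_univ, Fintype.card_fin]

/-- **PLAQUETTES OVER A SITE SET**: the level-`j` plaquettes whose source satisfies a predicate number at most `d²` times the sources (a plaquette is its
source and two directions). [cite: Balaban1985Averaging, (5) p.18 (plaquette convention; bookkeeping)] -/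
theorem card_filter_plaq_le {j : ℕ} (Q : Site P j → Prop) [DecidablePred Q] :
    ((Finset.univ : Finset (Plaq P j)).filter fun q => Q q.src).card ≤
      P.d ^ 2 * ((Finset.univ : Finset (Site P j)).filter Q).card := by
  classical
  have hmaps : ∀ q ∈ ((Finset.univ : Finset (Plaq P j)).filter fun q => Q q.src),
      (fun q : Plaq P j => (q.src, (q.μ, q.ν))) q ∈
        ((Finset.univ : Finset (Site P j)).filter Q) ×ˢ (Finset.univ : Finset (Fin P.d × Fin P.d)) := by
    intro q hq
    rw [Finset.mem_filter] at hq
    rw [Finset.mem_product, Finset.mem_filter]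
    exact ⟨⟨Finset.mem_univ _, hq.2⟩, Finset.mem_univ _⟩
  refine (Finset.card_le_card_of_injOn (fun q : Plaq P j => (q.src, (q.μ, q.ν)))
    (fun q hq => Finset.mem_coe.2 (hmaps q (Finset.mem_coe.1 hq))) ?_).trans ?_
  · rintro ⟨s₁, μ₁, ν₁, h₁⟩ _ ⟨s₂, μ₂, ν₂, h₂⟩ _ heq
    simp only [Prod.mk.injEq] at heq
    obtain ⟨rfl, rfl, rfl⟩ := heq
    rfl
  · rw [Finset.card_product, Finset.card_univ, Fintype.card_prod, Fintype.card_fin]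
    exact le_of_eq (by ring)

end Lattice

end Summit.QuantumFields.YangMills.BalabanUVNodes.N20LCSTorusCounting

end
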